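import Literature.Computability.MetaComplexity.McKayMurrayWilliams2019.UniformStreaming
import Literature.Computability.Complexity.TM2While
import Literature.Computability.Complexity.CodeFPArith
import HarnessLib

/-!
# Padding the input length: update machines that may work for `poly(N)` steps (tool for THEOREM E♯)

Support file for the kernel form of THEOREM E♯ of the solo report (under `NP ⊆ P` every language of
`P` has ONE polynomial-time one-pass streaming algorithm whose state stays within `O(log N)` bits of
the logarithm of its Myhill–Nerode class count).  The uniform streaming class `USTREAM S T` of
`UniformStreaming.lean` gives the update machine the input length `N` in BINARY together with the
current state `σ` and the next bit, and allows it `T N` steps.  When the state is short (the point of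
THEOREM E♯ is a state of `ν_L(N) + O(log N)` bits, possibly `O(log N)`), a polynomial-time STRING
FUNCTION of that input runs in time polynomial in `log N + |σ|` only and cannot do the `poly(N)` work
(searches over words of length `≤ N`) that the construction needs.  This file supplies the standard
remedy once and for all:

* `Pad.exists_padMachine` — ONE `TM2` machine maps `⟨bin N, π⟩ ↦ ⟨1ᴺ, ⟨bin N, π⟩⟩` within
  `q(N + |π|)` steps (a `while` loop of `max N 1` rounds over the words `⟨flag, 1ʲ, bin N, π⟩`,
  `TM2While.whileAux`, then a cut back to `1^{min N j}`);
* `Pad.exists_machine_of_codeFP` — hence every map `g(1ᴺ, N, π)` computed in polynomial time ON THE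
  PADDED CODE is computed by one machine from the unpadded input `⟨bin N, π⟩` within `q(N + |π|)`
  steps;
* `Pad.hasUniformUpdateTime_of_codeFP`, `Pad.hasUniformReportTime_of_codeFP` — the update /
  report clauses of `USTREAM` for a streaming algorithm whose update and acceptance maps are
  polynomial-time on padded codes, with time `q(N + S N)` for any space bound `S` on runs.

All statements proved; no hypotheses beyond those displayed.

References: S. Arora, B. Barak, *Computational Complexity: A Modern Approach*, CUP 2009, §1.3–1.4
(composition of machines; running a machine in a loop; counters); D. M. McKay, C. D. Murray,
R. R. Williams, *Weak lower bounds on resource-bounded compression imply strong separations of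
complexity classes*, STOC 2019, §2 (the streaming model: update time measured per bit as a function
of the input length).
-/

namespace Summit.PneNP.PneNP.Theorems.SoloBlind

open Computability Polynomial
open Literature.Computability.Complexity
open Literature.Computability.Complexity.CodeFP (natE unE bitE pairE strE pairE_apply
  unE_eq_ones length_unE length_natE_le)
open Literature.Computability.MetaComplexity
open Literature.Computability.MetaComplexity.McKayMurrayWilliams2019

namespace Pad

variable {π γ : Type} {eπ : π → List Bool} {eγ : γ → List Bool}

/-! ### Loop words -/

/-- Loop words `⟨flag, 1ʲ, bin N, payload⟩`. [folklore] -/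
abbrev LW (π : Type) : Type := Bool × ℕ × ℕ × π

/-- Code of the loop words (flag first, counter in unary, length in binary). [folklore] -/
abbrev lwE (eπ : π → List Bool) : LW π → List Bool := pairE bitE (pairE unE (pairE natE eπ))

/-- The flag after `i` rounds: down at the start, then raised iff the counter has reached `N`.
[folklore] -/
def fl (N : ℕ) : ℕ → Bool
  | 0 => false
  | i + 1 => decide (N ≤ i + 1)

/-- The orbit of the loop: after `i` rounds the word is `⟨fl N i, 1ⁱ, bin N, payload⟩`. [folklore] -/
def orbit (N : ℕ) (x : π) (i : ℕ) : List Bool := lwE eπ (fl N i, i, N, x)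

/-- A loop word starts with two copies of its flag. [folklore] -/
theorem orbit_eq_cons (N : ℕ) (x : π) (i : ℕ) :
    orbit (eπ := eπ) N x i = fl N i :: fl N i :: false :: true ::
      pairE unE (pairE natE eπ) (i, N, x) := rfl

/-- Length of a loop word. [folklore] -/
theorem length_lwE (f : Bool) (j N : ℕ) (x : π) :
    (lwE eπ (f, j, N, x)).length = 2 * j + 2 * (natE N).length + (eπ x).length + 8 := by
  simp only [pairE_apply, length_boolPair, bitE, List.length_singleton, length_unE]
  omega

/-! ### The code stages -/

/-- Pre-stage: `⟨bin N, π⟩ ↦ ⟨ff, 1⁰, bin N, π⟩`. [folklore] -/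
theorem cf_pre : CodeFP (pairE natE eπ) (lwE eπ) (fun t => (false, 0, t.1, t.2)) :=
  ((CodeFP.const _ false).pair ((CodeFP.const _ (0 : ℕ)).pair (CodeFP.id _))).congr fun _ => rfl

/-- Round stage: `⟨flag, 1ʲ, bin N, π⟩ ↦ ⟨[N ≤ j + 1], 1ʲ⁺¹, bin N, π⟩`. [folklore] -/
theorem cf_round : CodeFP (lwE eπ) (lwE eπ)
    (fun x => (decide (x.2.2.1 ≤ x.2.1 + 1), x.2.1 + 1, x.2.2.1, x.2.2.2)) := by
  have hj : CodeFP (lwE eπ) unE (fun x => x.2.1 + 1) := CodeFP.unSucc.comp (CodeFP.snd _ _).fst'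
  have hN : CodeFP (lwE eπ) natE (fun x => x.2.2.1) := (CodeFP.snd _ _).snd'.fst'
  have hx : CodeFP (lwE eπ) eπ (fun x => x.2.2.2) := (CodeFP.snd _ _).snd'.snd'
  exact ((CodeFP.natLeUn.comp (hN.pair hj)).pair (hj.pair (hN.pair hx))).congr fun _ => rfl

/-- Post-stage feeding a map `g` on padded codes: `⟨flag, 1ʲ, bin N, π⟩ ↦ g (min N j, N, π)`.
[folklore] -/
theorem cf_post {g : ℕ × ℕ × π → γ} (hg : CodeFP (pairE unE (pairE natE eπ)) eγ g) :
    CodeFP (lwE eπ) eγ (fun x => g (min x.2.2.1 x.2.1, x.2.2.1, x.2.2.2)) := by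
  have hj : CodeFP (lwE eπ) unE (fun x => x.2.1) := (CodeFP.snd _ _).fst'
  have hN : CodeFP (lwE eπ) natE (fun x => x.2.2.1) := (CodeFP.snd _ _).snd'.fst'
  have hx : CodeFP (lwE eπ) eπ (fun x => x.2.2.2) := (CodeFP.snd _ _).snd'.snd'
  exact (hg.comp ((CodeFP.unOfNatMin.comp (hj.pair hN)).pair (hN.pair hx))).congr fun _ => rfl

/-! ### The padding loop -/

/-- **The padding loop.** The `while` machine over the round stage maps `⟨ff, 1⁰, bin N, π⟩` to
`⟨tt, 1^{max N 1}, bin N, π⟩` within `q(N + |π|)` steps, for a fixed polynomial `q`.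
[cite: AroraBarak2009, §1.3–1.4 (running a machine in a loop; counters)] -/
theorem exists_loop : ∃ (ML : Turing.TM2ComputableAux Bool Bool) (q : Polynomial ℕ),
    ∀ (N : ℕ) (x : π), ML.OutputsWithin (orbit (eπ := eπ) N x 0) (orbit (eπ := eπ) N x (max N 1))
      (q.eval (N + (eπ x).length)) := by
  obtain ⟨pr, Mr, hr⟩ := (cf_round (eπ := eπ)).polyTimeComputable
  refine ⟨TM2While.whileAux Mr (fun a : Bool => a), (X + 1) * (pr.comp (4 * X + 10) + 8 * X + 22),
    fun N x => ?_⟩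
  set Q := N + (eπ x).length with hQ
  set R := pr.eval (4 * Q + 10) with hR
  obtain ⟨n, hn⟩ : ∃ n, max N 1 = n + 1 := ⟨max N 1 - 1, by omega⟩
  have hnat := length_natE_le N
  have hol : ∀ i ≤ n + 1, (orbit (eπ := eπ) N x i).length ≤ 4 * Q + 10 := fun i hi => by
    rw [orbit, length_lwE]
    omega
  -- one round
  have hround : ∀ i ≤ n, Mr.OutputsWithin (orbit (eπ := eπ) N x i) (orbit (eπ := eπ) N x (i + 1))
      R := by
    intro i hi
    have H := hr (fl N i, i, N, x)
    dsimp only at H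
    exact H.mono (TM2Iter.eval_mono pr (hol i (by omega)))
  have hgo : ∀ i < n, ∃ a rest, orbit (eπ := eπ) N x (i + 1) = a :: rest ∧
      (fun a : Bool => a) a = false :=
    fun i hi => ⟨_, _, orbit_eq_cons N x (i + 1), by
      have : ¬ N ≤ i + 1 := by omega
      simpa [fl] using this⟩
  have hstop : ∃ a rest, orbit (eπ := eπ) N x (n + 1) = a :: rest ∧ (fun a : Bool => a) a = true :=
    ⟨_, _, orbit_eq_cons N x (n + 1), by
      have : N ≤ n + 1 := by omega
      simpa [fl] using this⟩
  have HL := TM2While.whileAux_outputsWithin Mr (fun a : Bool => a) n (orbit (eπ := eπ) N x)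
    (fun _ => R) hround hgo hstop
  rw [hn]
  refine HL.mono ?_
  have hsum : ∑ i ∈ Finset.range (n + 1), (R + 2 * (orbit (eπ := eπ) N x (i + 1)).length + 2)
      ≤ (n + 1) * (R + 8 * Q + 22) := by
    have h := Finset.sum_le_card_nsmul (Finset.range (n + 1))
      (fun i => R + 2 * (orbit (eπ := eπ) N x (i + 1)).length + 2) (R + 8 * Q + 22)
      (fun i hi => by
        have hi' : i < n + 1 := Finset.mem_range.mp hi
        have := hol (i + 1) (by omega)
        omega)
    simpa using h
  have hq : ((X + 1) * (pr.comp (4 * X + 10) + 8 * X + 22) : Polynomial ℕ).eval Q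
      = (Q + 1) * (R + 8 * Q + 22) := by
    rw [hR]
    simp only [eval_mul, eval_add, eval_comp, eval_X, eval_ofNat, eval_one]
  rw [hq]
  exact hsum.trans (Nat.mul_le_mul_right _ (by omega))

/-- **The padding machine.** ONE `TM2` machine maps `⟨bin N, π⟩` to `⟨1ᴺ, ⟨bin N, π⟩⟩` within
`q(N + |π|)` steps, for a fixed polynomial `q`.
[cite: AroraBarak2009, §1.3–1.4 (composition of machines; counters)] -/
theorem exists_padMachine : ∃ (M : Turing.TM2ComputableAux Bool Bool) (q : Polynomial ℕ),
    ∀ (N : ℕ) (x : π), M.OutputsWithin (pairE natE eπ (N, x))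
      (pairE unE (pairE natE eπ) (N, N, x)) (q.eval (N + (eπ x).length)) := by
  obtain ⟨pp, Mp, hp⟩ := (cf_pre (eπ := eπ)).polyTimeComputable
  obtain ⟨ML, q, hL⟩ := exists_loop (eπ := eπ)
  obtain ⟨pc, Mc, hc⟩ := (cf_post (eπ := eπ) (CodeFP.id (pairE unE (pairE natE eπ)))).polyTimeComputable
  refine ⟨(Mp.comp ML).comp Mc, pp.comp (2 * X + 2) + q + pc.comp (4 * X + 10), fun N x => ?_⟩
  have hnat := length_natE_le N
  have H1 : Mp.OutputsWithin (pairE natE eπ (N, x)) (orbit (eπ := eπ) N x 0)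
      (pp.eval (pairE natE eπ (N, x)).length) := hp (N, x)
  have H2 := hL N x
  have H3 := hc (fl N (max N 1), max N 1, N, x)
  dsimp only at H3
  have hmin : min N (max N 1) = N := by omega
  rw [hmin] at H3
  have H := Turing.TM2ComputableAux.comp_outputsWithin _ _
    (Turing.TM2ComputableAux.comp_outputsWithin _ _ H1 H2) H3
  refine H.mono ?_
  set Q := N + (eπ x).length with hQ
  have hin : (pairE natE eπ (N, x)).length ≤ 2 * Q + 2 := by
    simp only [pairE_apply, length_boolPair]; omega
  have hlast : (lwE eπ (fl N (max N 1), max N 1, N, x)).length ≤ 4 * Q + 10 := by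
    rw [length_lwE]; omega
  have e : (pp.comp (2 * X + 2) + q + pc.comp (4 * X + 10) : Polynomial ℕ).eval Q
      = pp.eval (2 * Q + 2) + q.eval Q + pc.eval (4 * Q + 10) := by
    simp only [eval_add, eval_comp, eval_mul, eval_X, eval_ofNat]
  rw [e]
  have e1 := TM2Iter.eval_mono pp hin
  have e3 := TM2Iter.eval_mono pc hlast
  change _ ≤ _
  omega

/-- **Polynomial time on padded codes is polynomial time in `N`.** If `g(1ᴺ, N, π)` is computed in
polynomial time on the padded code `⟨1ᴺ, ⟨bin N, π⟩⟩`, then ONE machine computes it from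
`⟨bin N, π⟩` within `q(N + |π|)` steps. [cite: AroraBarak2009, §1.3 (composition)] -/
theorem exists_machine_of_codeFP {g : ℕ × ℕ × π → γ} (hg : CodeFP (pairE unE (pairE natE eπ)) eγ g) :
    ∃ (M : Turing.TM2ComputableAux Bool Bool) (q : Polynomial ℕ), ∀ (N : ℕ) (x : π),
      M.OutputsWithin (pairE natE eπ (N, x)) (eγ (g (N, N, x))) (q.eval (N + (eπ x).length)) := by
  obtain ⟨MP, q, hP⟩ := exists_padMachine (eπ := eπ)
  obtain ⟨pg, Mg, hMg⟩ := hg.polyTimeComputable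
  refine ⟨MP.comp Mg, q + pg.comp (6 * X + 4), fun N x => ?_⟩
  have hnat := length_natE_le N
  have H := Turing.TM2ComputableAux.comp_outputsWithin _ _ (hP N x) (hMg (N, N, x))
  refine H.mono ?_
  have hlen : (pairE unE (pairE natE eπ) (N, N, x)).length ≤ 6 * (N + (eπ x).length) + 4 := by
    simp only [pairE_apply, length_boolPair, length_unE]; omega
  have e := TM2Iter.eval_mono pg hlen
  simp only [eval_add, eval_comp, eval_mul, eval_X, eval_ofNat]
  omega

/-! ### The uniform time clauses of `USTREAM` from polynomial time on padded codes -/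

/-- **Uniform update time from a polynomial-time update map on padded codes.** If a map `u` with
`u (N, N, σ, b) = update` on every reached state `σ = reach A N x`, `|x| < N`, is polynomial-time on
the padded code `⟨1ᴺ, ⟨bin N, ⟨σ, b⟩⟩⟩`, and `A` runs in space `S`, then `A` has uniform update time
`q(N + S N)` for a fixed polynomial `q`.
[cite: McKayMurrayWilliams2019, §2 (update time as a function of the input length)] -/
theorem hasUniformUpdateTime_of_codeFP {A : StreamingAlgorithm} {u : ℕ × ℕ × (List Bool × Bool) → List Bool}
    (hu : CodeFP (pairE unE (pairE natE (pairE strE bitE))) strE u)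
    (hA : ∀ (N : ℕ) (x : List Bool) (b : Bool), x.length < N →
      u (N, N, reach A N x, b) = reach A N (x ++ [b]))
    {S : ℕ → ℕ} (hS : RunsInSpace A S) :
    ∃ q : Polynomial ℕ, HasUniformUpdateTime A (fun N => q.eval (N + S N)) := by
  obtain ⟨M, q, hM⟩ := exists_machine_of_codeFP hu
  refine ⟨q.comp (2 * X + 3), M, fun N x b hx => ?_⟩
  have H := hM N (reach A N x, b)
  rw [hA N x b hx] at H
  refine H.mono ?_
  have hσ := hS N x hx.le
  have hlen : (pairE strE bitE (reach A N x, b)).length ≤ 2 * S N + 3 := by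
    simp only [pairE_apply, length_boolPair, bitE, List.length_singleton, strE, id]; omega
  simpa only [eval_comp, eval_add, eval_mul, eval_X, eval_ofNat] using
    TM2Iter.eval_mono q
      (show N + (pairE strE bitE (reach A N x, b)).length ≤ 2 * (N + S N) + 3 by omega)

/-- **Uniform report time from a polynomial-time acceptance map on padded codes.** If a test `r`
with `r (N, N, σ) = A.accept N σ` on every final state is polynomial-time on the padded code
`⟨1ᴺ, ⟨bin N, σ⟩⟩`, and `A` runs in space `S`, then `A` has uniform report time `q(N + S N)`.
[cite: McKayMurrayWilliams2019, §2 (reporting time)] -/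
theorem hasUniformReportTime_of_codeFP {A : StreamingAlgorithm} {r : ℕ × ℕ × List Bool → Bool}
    (hr : CodeFP (pairE unE (pairE natE strE)) bitE r)
    (hA : ∀ x : List Bool, r (x.length, x.length, A.finalState x) = A.accept x.length (A.finalState x))
    {S : ℕ → ℕ} (hS : RunsInSpace A S) :
    ∃ q : Polynomial ℕ, HasUniformReportTime A (fun N => q.eval (N + S N)) := by
  obtain ⟨M, q, hM⟩ := exists_machine_of_codeFP hr
  refine ⟨q, M, fun x => ?_⟩
  have H := hM x.length (A.finalState x)
  rw [hA x] at H
  refine H.mono (TM2Iter.eval_mono q ?_)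
  have hσ : (A.finalState x).length ≤ S x.length := by
    rw [finalState_eq_reach]; exact hS _ _ le_rfl
  simpa only [strE, id] using Nat.add_le_add_left hσ x.length

end Pad

end Summit.PneNP.PneNP.Theorems.SoloBlind
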